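import Literature.Probability.LatticeModels.PlusStateHeatBath
import Literature.Probability.LatticeModels.IsingThermodynamics
import Literature.Probability.LatticeModels.LatticeLaplacianZd
import HarnessLib

/-!
# Stub `stub_dlrLaplacian` of line `superharmonic-comparison` (crux `TwoPointDoubling`, stmt-CriticalPhenomena-6150)

The DLR reading of the six-neighbour lattice Laplacian of the critical two-point function
`G = criticalTwoPoint 3` of the nearest-neighbour Ising model on `ℤ³`: for `x ≠ 0`,
`Σ_i (G(x+eᵢ) + G(x−eᵢ)) − 6 G(x) = ⟨σ₀ · (S_x − 6 tanh(β_c S_x))⟩⁺_{β_c,0}`,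
`S_x = Σ_i (σ_{x+eᵢ} + σ_{x−eᵢ})`.

Proof. The plus state at `β_c ≥ 0`, `h = 0` is represented on local observables by a DLR
probability measure `μ` (`exists_plusMeasure_integral_eq_plusExpect`), so every term is an
integral against the same `μ`; the one-site DLR (heat-bath) identity
`∫ σ_x σ₀ dμ = ∫ tanh(β_c Σ_{y∼x} σ_y) σ₀ dμ` (`IsGibbsMeasure.integral_spinAt_mul_eq_integral_tanh_mul`,
Friedli–Velenik 2017, Lemma 6.7) with `Σ_{y∼x} = Σ_i (· (x+eᵢ) + · (x−eᵢ))`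
(`sum_neighborFinset_zdGraph`) identifies `⟨σ₀ tanh(β_c S_x)⟩` with `G(x)`, and the rest is
linearity of the integral.
-/

noncomputable section

namespace Summit.CriticalPhenomena.Ising3DConformalLimit.Cruxes.TwoPointDoubling.SuperharmonicComparison

open scoped BigOperators
open MeasureTheory Filter Finset
open Literature.Probability.LatticeModels

/-- The pair observable `σ₀ σ_y` reads only the spins at `0` and `y`. -/
private theorem dlrLap_dependsOn_spinPair (y : Site 3) :
    DependsOn (spinPair (0 : Site 3) y) (↑({0, y} : Finset (Site 3)) : Set (Site 3)) := by
  intro σ τ hst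
  simp only [spinPair, spinAt, hst 0 (by simp), hst y (by simp)]

/-- **`stub_dlrLaplacian` — the DLR reading of the lattice Laplacian.**
For `x ≠ 0`: `Σ_i (G(x+eᵢ) + G(x−eᵢ)) − 6G(x) = ⟨σ₀ · (S_x − 6 tanh(β_c S_x))⟩⁺_{β_c,0}`, `S_x = Σ_i (σ_{x+eᵢ} + σ_{x−eᵢ})`,
`G = criticalTwoPoint 3`: the one-site DLR equation `⟨σ₀σ_x⟩ = ⟨σ₀ tanh(β_c S_x)⟩` of the infinite-volume plus state at `h = 0`
and linearity of the state on local observables. [FriedliVelenik2017 §3.6, Lemma 6.7, Thm. 6.26] -/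
theorem stub_dlrLaplacian :
    ∀ x : Literature.Probability.LatticeModels.Site 3, x ≠ 0 →
      (∑ i : Fin 3, (Literature.Probability.LatticeModels.criticalTwoPoint 3 (x + Pi.single i 1) +
          Literature.Probability.LatticeModels.criticalTwoPoint 3 (x - Pi.single i 1))) -
        6 * Literature.Probability.LatticeModels.criticalTwoPoint 3 x =
      Literature.Probability.LatticeModels.plusExpect 3 (Literature.Probability.LatticeModels.criticalBeta 3) 0
        (fun σ => Literature.Probability.LatticeModels.spinAt 0 σ *
          ((∑ i : Fin 3, (Literature.Probability.LatticeModels.spinAt (x + Pi.single i 1) σ +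
              Literature.Probability.LatticeModels.spinAt (x - Pi.single i 1) σ)) -
            6 * Real.tanh (Literature.Probability.LatticeModels.criticalBeta 3 *
              ∑ i : Fin 3, (Literature.Probability.LatticeModels.spinAt (x + Pi.single i 1) σ +
                Literature.Probability.LatticeModels.spinAt (x - Pi.single i 1) σ)))) := by
  intro x hx
  classical
  have hβ : 0 ≤ criticalBeta 3 := criticalBeta_nonneg 3
  obtain ⟨μ, hμP, hμG, -, -, hμE⟩ := exists_plusMeasure_integral_eq_plusExpect (d := 3) hβ 0
  -- (A) the two-point functions as integrals against `μ`, and their integrability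
  have hG : ∀ y : Site 3, criticalTwoPoint 3 y = ∫ σ, spinAt 0 σ * spinAt y σ ∂μ := fun y => by
    rw [criticalTwoPoint, twoPointPlus, hμE _ _ (dlrLap_dependsOn_spinPair y)]
    rfl
  have hI : ∀ y : Site 3, Integrable (fun σ : SpinConfig (Site 3) => spinAt 0 σ * spinAt y σ) μ :=
    fun y => integrable_of_dependsOn_finset μ _ (dlrLap_dependsOn_spinPair y)
  -- (B) the heat-bath identity at the site `x`, tested against `σ₀` (`x ≠ 0`)
  have hHB : ∫ σ, spinAt 0 σ * Real.tanh (criticalBeta 3 *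
      ∑ i : Fin 3, (spinAt (x + Pi.single i 1) σ + spinAt (x - Pi.single i 1) σ)) ∂μ =
      ∫ σ, spinAt 0 σ * spinAt x σ ∂μ := by
    have h := hμG.integral_spinAt_mul_eq_integral_tanh_mul (zdGraph 3) x (g := spinAt 0)
      (measurable_spinAt 0) ⟨1, fun σ => (abs_spinAt 0 σ).le⟩
      (fun σ u => by simp only [spinAt, Function.update_of_ne hx.symm])
    simp only [sum_neighborFinset_zdGraph] at h
    calc ∫ σ, spinAt 0 σ * Real.tanh (criticalBeta 3 *
          ∑ i : Fin 3, (spinAt (x + Pi.single i 1) σ + spinAt (x - Pi.single i 1) σ)) ∂μ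
        = ∫ σ, Real.tanh (criticalBeta 3 *
          ∑ i : Fin 3, (spinAt (x + Pi.single i 1) σ + spinAt (x - Pi.single i 1) σ)) * spinAt 0 σ ∂μ := by
          refine congrArg _ (funext fun σ => ?_)
          ring
      _ = ∫ σ, spinAt x σ * spinAt 0 σ ∂μ := h.symm
      _ = ∫ σ, spinAt 0 σ * spinAt x σ ∂μ := by
          refine congrArg _ (funext fun σ => ?_)
          ring
  -- (C) the right-hand observable is local: it reads the spins at `0` and at the `x ± eᵢ`
  obtain ⟨D, hmem0, hmemp, hmemm⟩ : ∃ D : Finset (Site 3), (0 : Site 3) ∈ D ∧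
      (∀ i : Fin 3, x + Pi.single i 1 ∈ D) ∧ ∀ i : Fin 3, x - Pi.single i 1 ∈ D :=
    ⟨insert 0 ((univ.image fun i : Fin 3 => x + Pi.single i 1) ∪
        univ.image fun i : Fin 3 => x - Pi.single i 1),
      mem_insert_self _ _,
      fun i => mem_insert_of_mem (mem_union_left _ (mem_image_of_mem _ (mem_univ i))),
      fun i => mem_insert_of_mem (mem_union_right _ (mem_image_of_mem _ (mem_univ i)))⟩
  have h0dep : ∀ {σ τ : SpinConfig (Site 3)}, (∀ i ∈ (↑D : Set (Site 3)), σ i = τ i) →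
      spinAt 0 σ = spinAt 0 τ := fun hst => by
    simp only [spinAt, hst _ (Finset.mem_coe.2 hmem0)]
  have hSdep : ∀ {σ τ : SpinConfig (Site 3)}, (∀ i ∈ (↑D : Set (Site 3)), σ i = τ i) →
      (∑ i : Fin 3, (spinAt (x + Pi.single i 1) σ + spinAt (x - Pi.single i 1) σ)) =
        ∑ i : Fin 3, (spinAt (x + Pi.single i 1) τ + spinAt (x - Pi.single i 1) τ) := fun hst => by
    refine Finset.sum_congr rfl fun i _ => ?_
    simp only [spinAt, hst _ (Finset.mem_coe.2 (hmemp i)), hst _ (Finset.mem_coe.2 (hmemm i))]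
  have hTdep : DependsOn (fun σ : SpinConfig (Site 3) => spinAt 0 σ * Real.tanh (criticalBeta 3 *
      ∑ i : Fin 3, (spinAt (x + Pi.single i 1) σ + spinAt (x - Pi.single i 1) σ)))
      (↑D : Set (Site 3)) := fun σ τ hst => by
    show spinAt 0 σ * _ = spinAt 0 τ * _
    rw [h0dep hst, hSdep hst]
  have hT6 : Integrable (fun σ : SpinConfig (Site 3) => 6 * (spinAt 0 σ * Real.tanh (criticalBeta 3 *
      ∑ i : Fin 3, (spinAt (x + Pi.single i 1) σ + spinAt (x - Pi.single i 1) σ)))) μ :=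
    (integrable_of_dependsOn_finset μ D hTdep).const_mul 6
  have hIsum : Integrable (fun σ : SpinConfig (Site 3) => ∑ i : Fin 3,
      (spinAt 0 σ * spinAt (x + Pi.single i 1) σ + spinAt 0 σ * spinAt (x - Pi.single i 1) σ)) μ :=
    integrable_finsetSum _ fun i _ => (hI (x + Pi.single i 1)).fun_add (hI (x - Pi.single i 1))
  have hF : DependsOn (fun σ : SpinConfig (Site 3) => spinAt 0 σ *
      ((∑ i : Fin 3, (spinAt (x + Pi.single i 1) σ + spinAt (x - Pi.single i 1) σ)) -
        6 * Real.tanh (criticalBeta 3 *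
          ∑ i : Fin 3, (spinAt (x + Pi.single i 1) σ + spinAt (x - Pi.single i 1) σ))))
      (↑D : Set (Site 3)) := fun σ τ hst => by
    show spinAt 0 σ * _ = spinAt 0 τ * _
    rw [h0dep hst, hSdep hst]
  -- (D) assemble: everything is an integral against `μ`; expand by linearity
  have hsplit : ∀ σ : SpinConfig (Site 3), spinAt 0 σ *
      ((∑ i : Fin 3, (spinAt (x + Pi.single i 1) σ + spinAt (x - Pi.single i 1) σ)) -
        6 * Real.tanh (criticalBeta 3 *
          ∑ i : Fin 3, (spinAt (x + Pi.single i 1) σ + spinAt (x - Pi.single i 1) σ))) =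
      (∑ i : Fin 3, (spinAt 0 σ * spinAt (x + Pi.single i 1) σ + spinAt 0 σ * spinAt (x - Pi.single i 1) σ)) -
        6 * (spinAt 0 σ * Real.tanh (criticalBeta 3 *
          ∑ i : Fin 3, (spinAt (x + Pi.single i 1) σ + spinAt (x - Pi.single i 1) σ))) := fun σ => by
    rw [mul_sub, Finset.mul_sum]
    simp only [mul_add]
    ring
  simp only [hG]
  rw [hμE D _ hF]
  simp_rw [hsplit]
  have hsum : ∫ σ, ∑ i : Fin 3,
      (spinAt 0 σ * spinAt (x + Pi.single i 1) σ + spinAt 0 σ * spinAt (x - Pi.single i 1) σ) ∂μ =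
      ∑ i : Fin 3, (∫ σ, spinAt 0 σ * spinAt (x + Pi.single i 1) σ ∂μ +
        ∫ σ, spinAt 0 σ * spinAt (x - Pi.single i 1) σ ∂μ) :=
    (integral_finsetSum _ fun i _ => (hI (x + Pi.single i 1)).fun_add (hI (x - Pi.single i 1))).trans
      (Finset.sum_congr rfl fun i _ => integral_add (hI (x + Pi.single i 1)) (hI (x - Pi.single i 1)))
  rw [integral_sub hIsum hT6, integral_const_mul, hsum, hHB]

end Summit.CriticalPhenomena.Ising3DConformalLimit.Cruxes.TwoPointDoubling.SuperharmonicComparison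

end
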